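import Mathlib
import HarnessLib
import HarnessLib.Audit
import Summits.MatrixMultiplication.Statement
import Literature.Computability.AlgebraicComplexity.AsymptoticSpectrum
import Literature.Computability.AlgebraicComplexity.MatrixMultiplicationExponent
import Literature.Computability.AlgebraicComplexity.FlatteningBound
import HarnessLib.Audit.Status.Attr

/-!
Route: ModularHeisenberg

DORMANT since 2026-08-22T14:04:15Z (reconciler: no traction for 5.4 d (last activity item-evidence-added at 2026-08-17T04:11:17Z); parked, not closed — `ledger route dormant route-MatrixMultiplication-ModularHeisenberg --off` to reactiv) — unstaffed, not closed; items shared with open routes are served there. `ledger route dormant <id> --off` reactivates.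

# Route ModularHeisenberg — omega = 2 read off one integer tensor in two characteristics — the
modular Heisenberg group algebra

X = CharacteristicLift ∧ ModularHeisenbergMinimal ("it suffices to show X"; realises card
modular-heisenberg-transfer). Let T_p be
the multiplication table of the Heisenberg group H_p = U_3(ℤ/p) — the 0/1 tensor on (Fin p)³ with
entry [x·y = z],
(a,b,c)·(a',b',c') = (a+a', b+b', c+c'+ab') — read over two fields: over ℂ it is the structure
tensor of
ℂ[H_p] ≅ ℂ^(p²) × M_p(ℂ)^(p−1), so (p−1)·p^ω(ℂ) ≤ R~_ℂ(T_p) (Wedderburn + Schönhage's τ-theorem in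
asymptotic-rank form,
both PROVED in the cone); over F̄_p it is the structure tensor of the LOCAL algebra F̄_p[H_p].
CharacteristicLift: for every
prime p, R~_ℂ(T_p) ≤ R~_(F̄_p)(T_p) (characteristic p is never asymptotically cheaper for T_p).
ModularHeisenbergMinimal: for
every ε > 0 and all large primes p, R~_(F̄_p)(T_p) ≤ p^(3+ε) (the modular Heisenberg algebra is
asymptotically as cheap as its
dimension). Then (p−1)p^ω ≤ p^(3+ε) for all large p forces ω(ℂ) ≤ 2, and ω(ℂ) ≥ 2 is in Theorems.
Lean: `(∀ (p : ℕ) [Fact p.Prime], Literature.Computability.AlgebraicComplexity.asymptoticRank (fun z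
x y : Fin p × Fin p × Fin p => if x.1 + y.1 = z.1 ∧ x.2.1 + y.2.1 = z.2.1 ∧ x.2.2 + y.2.2 + x.1 *
y.2.1 = z.2.2 then (1 : ℂ) else 0) ≤ Literature.Computability.AlgebraicComplexity.asymptoticRank
(fun z x y : Fin p × Fin p × Fin p => if x.1 + y.1 = z.1 ∧ x.2.1 + y.2.1 = z.2.1 ∧ x.2.2 + y.2.2 +
x.1 * y.2.1 = z.2.2 then (1 : AlgebraicClosure (ZMod p)) else 0)) ∧ (∀ ε : ℝ, 0 < ε → ∃ p₀ : ℕ, ∀ (p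
: ℕ) [Fact p.Prime], p₀ ≤ p → Literature.Computability.AlgebraicComplexity.asymptoticRank (fun z x y
: Fin p × Fin p × Fin p => if x.1 + y.1 = z.1 ∧ x.2.1 + y.2.1 = z.2.1 ∧ x.2.2 + y.2.2 + x.1 * y.2.1
= z.2.2 then (1 : AlgebraicClosure (ZMod p)) else 0) ≤ (p : ℝ) ^ (3 + ε))`

## Assembly
Pure real analysis plus the infinitude of primes (sorry-free shape checked in Sketch.lean: Assembly
unfolds to … → omega ℂ = 2):
HeisenbergLowerFrame gives (p−1)p^ω ≤ R~_ℂ(T_p), CharacteristicLift gives R~_ℂ(T_p) ≤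
R~_(F̄_p)(T_p), ModularHeisenbergMinimal gives
R~_(F̄_p)(T_p) ≤ p^(3+ε) for p ≥ p₀(ε); hence p^(ω−2−ε) ≤ p/(p−1) ≤ 2 for all primes p ≥ p₀(ε). If ω
> 2 take ε = (ω−2)/2 and let
p → ∞ along the primes (Nat.exists_infinite_primes): contradiction. So ω(ℂ) ≤ 2, and 2 ≤ ω(ℂ)
(Theorems/AsymptoticSpectrumOmegaGeTwo.two_le_omega) gives MatrixMultiplication (= omega ℂ = 2,
MatrixMultiplication_iff).

Rationale: WHY THIS LINE. Cohn–Umans (CohnUmans2003) read ω off group algebras over ℂ; here ONE integer tensor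
is read in two characteristics: the p−1 matrix
blocks M_p(ℂ) that carry ω over ℂ dissolve, over F̄_p, into a LOCAL algebra — a filtered deformation
of the restricted enveloping
algebra u(h_p) (Jennings–Quillen, doi:10.1016/0021-8693(68)90069-0) and thereby of the commutative
truncated polynomial ring
F̄_p[x,y,z]/(x^p,y^p,z^p) — so ω = 2 becomes "characteristic transfer of
asymptotic rank (CharacteristicLift) + an asymptotic-rank-conjecture instance for a LOCAL algebra in
characteristic p
(ModularHeisenbergMinimal)" (BurgisserClausenShokrollahi1997 Problem 15.5, Cor. 15.18: transfer is
known for field EXTENSIONS only).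
Imported area: modular representation theory of p-groups (Jennings/Quillen filtrations, restricted
enveloping algebras, Lazard exp/log
for class 2 < p) and arithmetic lifting (Hensel / Witt vectors, sibling card
hensel-rees-obstruction-calculus); the honest caveat,
stated up front: CharacteristicLift ∧ ModularHeisenbergMinimal implies R~_ℂ(ℂ[H_p]) ≤ p^(3+o(1)),
which over ℂ is EQUIVALENT to
ω = 2, so the value of the line is the split itself — a purely char-p algorithmic statement with a
concrete first milestone
(SubQuarticModular: beat the p⁴ of the skew-polynomial presentation, the only bound known in
characteristic p) plus a transfer
statement with no counterpart in prior routes (AsymptoticRankCW, AsymptoticSpectrum,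
GroupTheoreticSTPP all live over ℂ; the negatives
index is empty). Degenerations go the wrong way for upper bounds (gr F̄_p[H_p] = u(h_p) and
F̄_p[x,y,z]/(x^p,y^p,z^p) are minimal or
near-minimal but only bound F̄_p[H_p] from BELOW), which is exactly why ModularHeisenbergMinimal is
a crux and not a corollary.

RANKED CRUXES. #2 SubQuarticModular (crux) — the first informative step of the dial MH_δ ⇒ ω ≤ 2+δ
(card §Mechanism): some fixed c > 0 and all large primes p have R~ over F̄_p of T_p at most p^(4−c),
i.e. the modular Heisenberg group algebra is asymptotically cheaper than its skew-polynomial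
presentation F̄_p[(ℤ/p)²] ⋊ C_p (which gives exactly p⁴ = p·R~(F̄_p[x,y,z]/(x^p,y^p,z^p)), support
item QuarticCalibration). Implied by the asymptotic rank conjecture over F̄_p (T_p is concise of
format p³); does not imply the thesis but is where provers can move (an explicit Kronecker-power
scheme in characteristic p) and where a refutation would refute ARC over F̄_p. [difficulty: L] (why
it might fail: every known presentation (skew-polynomial ring over F̄_p[(ℤ/p)²]; normal-ordered star
product Σ_k Z^k/k!·∂^k f·∂^k g) costs p·R~(F̄_p[x,y,z]/(x^p,y^p,z^p)) = p⁴ exactly; beating 4 needs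
a new use of the unipotent twist; no char-p lower bound beyond flattening (p³) exists to guide.)
[BlaserLysikov2016, BurgisserClausenShokrollahi1997, doi:10.1515/1569392053310409,
doi:10.1515/dma.2010.041, doi:10.1007/978-3-642-20877-5_2]
#3 CharacteristicLift (crux) — characteristic transfer of asymptotic rank for the Heisenberg table
(card Crux 1, CT-lift): for every prime p, R~_ℂ(T_p) ≤ R~ over F̄_p of the same 0/1 tensor T_p
(equivalently over any field of characteristic p, ranks only dropping under extension; ℂ may be
replaced by any algebraically closed field of characteristic 0). The novel load-bearing ingredient:
it makes characteristic-p methods admissible for the complex exponent. Proposed mechanism (sibling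
card hensel-rees-obstruction-calculus): near-optimal F̄_p-decompositions of T_p^(⊗n) become
Hensel-unobstructed after padding p^(o(n)), lift to Witt vectors W(F̄_p) ⊂ an algebraically closed
field of characteristic 0, and R~ over all such fields agrees with R~_ℂ. [difficulty: open-problem]
(why it might fail: no mechanism beyond hoped-for Hensel lifting; finite-level lifting fails
(arXiv:2212.01175 §5: no rank-47 F_2-scheme of ⟨4,4,4⟩ lifts to ℤ/4); transfer IS false for
non-concise reductions ((P⊗P⊗P)·⟨n⟩, det P = p) and for asymptotic SUBRANK (T_(ℤ/2): 2 over ℂ vs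
1.89 over F̄_2).) [arXiv:2212.01175, BurgisserClausenShokrollahi1997, ChristandlVranaZuiddam2023,
arXiv:2602.13171]
#4 ModularHeisenbergMinimal (crux) — asymptotic-rank minimality of the modular Heisenberg group
algebra along the primes (card Crux 2, MH): for every ε > 0 there is p₀ such that for all primes p ≥
p₀ the asymptotic rank over F̄_p of T_p is at most p^(3+ε). T_p is concise (unital algebra) so p³ is
a lower bound in every characteristic; MH is the asymptotic rank conjecture over F̄_p for this one
family with sub-polynomial slack. Implies SubQuarticModular; with CharacteristicLift and the lower
frame it gives ω(ℂ) = 2. [deps: SubQuarticModular] [difficulty: open-problem] (why it might fail: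
F̄_p[H_p] is unital non-commutative ⇒ bR > p³ (BlaserLysikov2016 Cor. 7) and local ⇒ irreversible
(slice rank < (1−c)p³, BCCGU17 §3), so no duality shortcut; its degenerations u(h_p),
F̄_p[x,y,z]/(x^p,…) bound it from below only; nothing below p⁴ is known; with CTLift it is
equivalent to ω=2.) [BlaserLysikov2016, BlasiakChurchCohnGrochowUmans2017,
BurgisserClausenShokrollahi1997, CohnUmans2003, Sawin2018]
#9 HeisenbergLowerFrame (support) — the complex lower frame: for every prime p, (p−1)·p^ω(ℂ) ≤
R~_ℂ(T_p). Provable now from the cone: T_p is (a reindexing of) groupTensor ℂ H_p for the evident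
group structure on (Fin p)³ (GroupAlgebraTensor.groupTensor, groupTensor_eq_structureTensor);
Wedderburn φ : ℂ[H_p] ≃ₐ ∏ M_(d_i)(ℂ) (WedderburnBlocks.exists_algEquiv_pi_matrix, PROVED) with p²
blocks of size 1 (H_p/[H_p,H_p] ≅ (ℤ/p)²) and p−1 blocks of size p (d_i² ≤ [H_p : Z] = p², Σ d_i² =
p³; or explicitly via the p−1 Weyl clock–shift representations x ↦ shift, y ↦ diag(ζ^(jb)));
structureTensor_restrictsTo_of_algEquiv + structureTensor_blockBasis_eq_matMulDirectSum give T_p ≥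
⊕_i ⟨d_i,d_i,d_i⟩, restriction-monotonicity of R~ (TensorRestrictsTo.kroneckerPow + tensorRank_le)
and sum_rpow_omega_le_asymptoticRank (Schönhage τ-theorem, R~ form, PROVED) give Σ_i d_i^ω ≤
R~_ℂ(T_p), and Σ_i d_i^ω ≥ (p−1)p^ω. [difficulty: provable-now] [CohnUmans2003,
BurgisserClausenShokrollahi1997, AlmanDuanVassilevskaWilliamsXuXuZhou2025]
#9 QuarticCalibration (support) — the trivial end of the dial (δ = 1 ↔ ω ≤ 3) in characteristic p:
for every prime p, R~ over F̄_p of T_p is at most p⁴. Proof: N = {(0,b,c)} ≅ (ℤ/p)² is abelian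
normal of index p with coset representatives x^i = (i,0,0), and (x^i β)(x^j β') =
x^(i+j)·Ad_(x^(−j))(β)·β', so T_p is a restriction of ⊕_((i,j) ∈ (ℤ/p)²) T_(F̄_p[N]) (p² twisted
copies; R~ is subadditive), and R~(F̄_p[N]) ≤ bR(F̄_p[u,v]/(u^p,v^p)) = p² (smoothable:
arXiv:1606.04253 Def. 3 / Cor. 7, over any algebraically closed field) by the smoothing u^p −
δ^(p−1)u (Lagrange idempotents at 0, δζ^i give an order-O(p²) approximate decomposition over
F̄_p[δ]; asymptoticRank_le_algBorderRank). Builds the char-p infrastructure (coset presentation,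
minimal border rank of F̄_p[(ℤ/p)²]) every attack on SubQuarticModular starts from. [difficulty: M]
[BlaserLysikov2016, BurgisserClausenShokrollahi1997, Blaser2013]

TWO-LAYER PLAN. Foreseen glued splits (none filed now; k ≤ 3, depth 1): CharacteristicLift ⇐
HenselUnobstructed (near-optimal F̄_p-decompositions of
T_p^(⊗n) are unobstructed after p^(o(n)) padding: obstruction classes in coker dΦ die in higher
powers) → WittToComplex (all-order lifts
give decompositions over an algebraically closed field of characteristic 0, where R~ equals R~_ℂ) →
CharacteristicLift.
ModularHeisenbergMinimal ⇐ LazardModel (for p odd, F̄_p[H_p] ≅ u(h_p) as ALGEBRAS via truncated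
exp/log — an isomorphism, not the
Jennings–Quillen degeneration; to be checked at p = 3 first) → StarProductMinimality (R~(u(h_p)) ≤
p^(3+o(1)) for the normal-ordered
star product on F̄_p[X,Y,Z]/(X^p,Y^p,Z^p)) → ModularHeisenbergMinimal. SubQuarticModular is the
natural first child-by-weakening of
StarProductMinimality and stays a layer-1 item.

KILL CRITERIA. refuted:CharacteristicLift (some prime p with R~_(F̄_p)(T_p) < R~_ℂ(T_p)) closes the
route outright and retires the transfer philosophy
(hand the witness to cards hensel-rees-obstruction-calculus / arithmetic-of-omega as negative
knowledge); note it needs an R~ lower bound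
over ℂ above the flattening bound, i.e. new lower-bound technology or ω(ℂ) > 2.
refuted:ModularHeisenbergMinimal or
refuted:SubQuarticModular (R~_(F̄_p)(T_p) ≥ p^(3+c), resp. ≥ p^(4−o(1)), along infinitely many
primes) closes the route and is a
refutation of the asymptotic rank conjecture over F̄_p — file it as a Literature-grade negative. A
proof of SubQuarticModular with
c ≥ 0.63 (R~ ≤ p^3.37) makes char p provably competitive with the complex record and forces a pivot
of staffing onto
CharacteristicLift. ω(ℂ) = 2 by any other route moots the line; ARC over all fields proves
ModularHeisenbergMinimal outright.

NOT DECOMPOSED YET. The Hensel/Witt obstruction calculus behind CharacteristicLift (needs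
definitions: decompositions over ℤ/p^k and W(F̄_p), Terracini
cokernel) — layer-2 children once a grounder confirms the shape; the algebra isomorphism F̄_p[H_p]
≅? u(h_p) (p odd) and the p = 2 case
(T_2 is the table of the dihedral group of order 8, harmless for statements along p → ∞); the
identification of the inline tensor with
groupTensor ℂ H_p for a Mathlib Group instance (prover-side plumbing inside HeisenbergLowerFrame);
exact character degrees of H_p; any
quantitative version of the assembly (MH_δ ∧ CTLift ⇒ ω ≤ 2+δ) — a support statement to add when
SubQuarticModular moves.

CHEAPEST FALSIFIER. There is no lower-bound method for asymptotic rank beyond flattening ranks in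
ANY characteristic, so neither crux can be killed by a
known theorem; the cheapest informative checks are computations at p = 2, 3: (i) flip-graph / SAT
search (Kauers–Moosbauer
arXiv:2212.01175 tooling works natively over F_2, F_3) for low-rank schemes of T_3 (27×27×27,
F̄_3[H_3]) and T_2^(⊠2) over F_p versus
over ℚ — a char-p scheme for T_3 with fewer than 81 = 3⁴ products, or for T_3^(⊠2) with fewer than
81², is the first evidence that
SubQuarticModular is real; at level 1 the two windows overlap only in [53, 55] (R ≥ 2·27−1 = 53 over
F̄_3 for the local algebra,
AlderStrassen1981, versus R_ℂ ≤ 9 + 2·R(⟨3,3,3⟩) ≤ 55), so level ≥ 2 is where transfer can first be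
probed; (ii) literature lookup of
exact modular group-algebra ranks (Alekseev–Pospelov doi:10.1515/1569392053310409, Chokaev
doi:10.1515/dma.2010.041, Pospelov
doi:10.1007/978-3-642-20877-5_2) for any asymptotic statement in characteristic p. Not run here
(plancard seat, no kit budget).

NUMBERS. ω(ℂ) < 2.371339 (AlmanDuanVassilevskaWilliamsXuXuZhou2025), so R~_ℂ(T_p) = p² + (p−1)p^ω ∈
[p³, p^3.3714]; characteristic-p window:
p³ (flattening; T_p concise) ≤ R~_(F̄_p)(T_p) ≤ p⁴ (QuarticCalibration); dial: MH_δ ∧ CTLift ⇒ ω ≤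
2+δ, δ = 1 free, δ < 0.3714 beats
the record, δ = 0 is the thesis. Level-1 ranks: R_(F̄_p)(T_p) ≥ 2p³ − 1 (AlderStrassen1981, one
maximal ideal) versus
R_ℂ(T_p) ≤ p² + (p−1)·R(⟨p,p,p⟩) (p = 3: ≥ 53 over F̄_3, ≤ 9 + 2·23 = 55 over ℂ). Asymptotic subrank
is NOT characteristic-free
(T_(ℤ/2): Q~ = 2 over ℂ, 2^h(1/3) ≈ 1.89 over F̄_2, ChristandlVranaZuiddam2023). Items at open: 6 (3
cruxes, 2 support, 1 assembly).

DEFINITION REQUESTS. None needed: T_p is inlined over Fin p × Fin p × Fin p (associativity and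
non-commutativity of the inline law checked by native_decide
at p = 2, 3 in Sketch.lean); asymptoticRank, omega, groupTensor, algBorderRank exist in
Literature.Computability.AlgebraicComplexity.
Nice-to-have later (not filed): a named `heisenbergGroup p` with `groupTensor` identification, and
decompositions over ℤ/p^k for the
Hensel children.

Novelty: Searches (2026-08-15): `lit search --source zbmath "bilinear complexity group algebra"` (10:
Atkinson 1977, de Groote 1983, Ye–Lim 2018 …);
`lit search --source zbmath "multiplicative complexity group algebras"` (12: Alekseev–Pospelov 2005
doi:10.1515/1569392053310409);
`lit search --source crossref "Pospelov complexity of multiplication in group algebras"` (7: Chokaev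
2010 doi:10.1515/dma.2010.041 and
doi:10.3103/s0278641910040059 — commutative modular group algebras; Pospelov 2011
doi:10.1007/978-3-642-20877-5_2);
`lit search --source crossref "rank of modular group algebra multiplication tensor"` (8, none
relevant); `lit frontier MatrixMultiplication
--since 2021` (30; nearest: arXiv:2602.13171 complex→rational schemes, arXiv:2602.11041); `lit
bridges MatrixMultiplication --cross any` (30,
textbooks only); `lit galaxy search "multiplication in group algebras" --star pdf` (1, irrelevant),
`"bilinear complexity" --star pdf` (8,
irrelevant), `--star all` queries saturated/0 rows (logged in NOTES); local searchd down,
OpenAlex/S2/arXiv rate-limited this session. Card-level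
audit (refuter, 2026-08-15) already searched BCS pp. 417–418/447/452–453, CohnUmans2003,
arXiv:1605.06702, Sawin2018.
Nearest prior art found: CohnUmans2003 (ω from group algebras over ℂ; H_p is a perfect TPP host),
BurgisserClausenShokrollahi1997 Problem 15.5 /
Cor. 15.18 (ARC ⇒ ω = 2; transfer only along field extensions), modular group algebras as
OBSTRUCTIONS only
(BlasiakChurchCohnGrochowUmans2017 §3, S  [refs: 10.1515/1569392053310409, 10.1515/dma.2010.041, 10.3103/s0278641910040059, 10.1007/978-3-642-20877-5_2, 2602.13171, 2602.11041, 1605.06702, 2212.01175, doi:10.1515/1569392053310409, doi:10.1515/dma.2010.041, doi:10.3103/s0278641910040059, doi:10.1007/978-3-642-20877-5_2, CohnUmans2003, Sawin2018, BurgisserClausenShokrollahi1997, BlasiakChurchCohnGrochowUmans2017]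

Barriers (technique_class: characteristic-transfer, modular-group-algebra): - technique_class: characteristic-transfer, modular-group-algebra, structure-tensor-of-algebra,
asymptotic-rank
- Literature.Barriers.MatrixMultiplication.UnstableTensorBarrier: class (b) "structure tensors of
non-semisimple algebras of BOUNDED dimension, over ℂ, via arbitrary restrictions from powers" —
evaded three ways: the size p³ → ∞ (its evasion (i)), the non-semisimple reading lives over F̄_p
where entanglement polytopes do not exist (its scope caveat (a), BL Rem. 26), and ⟨p,p,p⟩ is never
extracted from powers of T_p by restriction — over ℂ, T_p is the (polystable) structure tensor of a
SEMISIMPLE algebra containing M_p as a direct summand. Its moral survives as the why-might-fail of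
ModularHeisenbergMinimal: F̄_p[H_p] is irreversible, so no duality shortcut.
- Literature.Barriers.MatrixMultiplication.NilpotentGroupBarrier: about STPP constructions in
bounded-exponent nilpotent groups read through inequality (2.2); no TPP/STPP packing is used (M_p is
a literal Wedderburn summand), and its slice-rank input is exactly the recorded instability of
F̄_p[H_p] — it does not apply; the bet is on rank, not subrank.
- Literature.Barriers.MatrixMultiplication.IrreversibilityBarrier: bounds ω-certificates of the form
ω(⟨2⟩,t)·ω(t,⟨2,2,2⟩) through a fixed intermediate t; the line certifies via an identity of tensors
across characteristics plus an asymptotic-rank upper bound, with growing t = T_p — not in class.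
- Literature.Barriers.MatrixMultiplication.UniversalMethodBarrier: sam

Novelty grade: new-combination — ROUTE REVIEW (refuter, 2026-08-15; full = REVIEW-ModularHeisenberg.md on stmt-4348/4352). VERDICT keep, WITH OBJECTION O1. Not a recombination: no closed MM route; HenselReesLifting (open) is a different costume, no shared decls. TYPING OK: inline T_p = Heisenberg law (a+a',b+b',c+c'+ab') in Fin p ( (refuter refuter-rreview-route-AtomisticToContinu-771e1018-0, 2026-08-15T13:38:04Z; prior: CohnUmans2003, BurgisserClausenShokrollahi1997, doi:10.1515/1569392053310409, doi:10.1515/dma.2010.041, doi:10.1007/978-3-642-20877-5_2, arXiv:2212.01175, BlasiakChurchCohnGrochowUmans2017, Sawin2018, ChristandlVranaZuiddam2023)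

History (route lifecycle, newest last):
- 2026-08-22T14:04:15Z · DORMANT — reconciler: no traction for 5.4 d (last activity item-evidence-added at 2026-08-17T04:11:17Z); parked, not closed — `ledger route dormant route-MatrixMultiplica (operator:999:2717798)

sub-problem: MatrixMultiplication · status: dormant · opened planner-plancard-MatrixMultiplication-MatrixM-065dce56-0 2026-08-15T11:32:44Z · rev 1 · ledger route-MatrixMultiplication-ModularHeisenberg
GENERATED by the gate from the ledger (D-0016/17). Provers cite these decls: `theorem foo : Summit.MatrixMultiplication.MatrixMultiplication.Theses.ModularHeisenberg.<Decl> := …` in Summits/MatrixMultiplication/MatrixMultiplication/Theorems/<Name>.lean.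
-/

namespace Summit.MatrixMultiplication.MatrixMultiplication.Theses.ModularHeisenberg

open scoped BigOperators Topology Manifold Classical MeasureTheory ProbabilityTheory Matrix InnerProductSpace ComplexConjugate ContinuousMap
open Filter Set Function TopologicalSpace MeasureTheory

attribute [summit_statement] _root_.MatrixMultiplication

/-- item stmt-MatrixMultiplication-4347 · crux · rank 2 · open · by planner
why it might fail: every known presentation (skew-polynomial ring over F̄_p[(ℤ/p)²]; normal-ordered star product Σ_k Z^k/k!·∂^k f·∂^k g) costs p·R~(F̄_p[x,y,z]/(x^p,y^p,z^p)) = p⁴ exactly; beating 4 needs a new use of the unipotent twist; no char-p lower bound beyond flattening (p³) exists to guide.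
sources: BlaserLysikov2016, BurgisserClausenShokrollahi1997, doi:10.1515/1569392053310409, doi:10.1515/dma.2010.041, doi:10.1007/978-3-642-20877-5_2
[crux] the first informative step of the dial MH_δ ⇒ ω ≤ 2+δ (card §Mechanism): some fixed c > 0 and
all large primes p have R~ over F̄_p of T_p at most p^(4−c), i.e. the modular Heisenberg group
algebra is asymptotically cheaper than its skew-polynomial presentation F̄_p[(ℤ/p)²] ⋊ C_p (which
gives exactly p⁴ = p·R~(F̄_p[x,y,z]/(x^p,y^p,z^p)), support item QuarticCalibration). Implied by the
asymptotic rank conjecture over F̄_p (T_p is concise of format p³); does not imply the thesis but is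
where provers can move (an explicit Kronecker-power scheme in characteristic p) and where a
refutation would refute ARC over F̄_p. [difficulty: L] -/
@[route_item "route-MatrixMultiplication-ModularHeisenberg"]
def SubQuarticModular : Prop :=
  ∃ c : ℝ, 0 < c ∧ ∃ p₀ : ℕ, ∀ (p : ℕ) [Fact p.Prime], p₀ ≤ p → Literature.Computability.AlgebraicComplexity.asymptoticRank (fun z x y : Fin p × Fin p × Fin p => if x.1 + y.1 = z.1 ∧ x.2.1 + y.2.1 = z.2.1 ∧ x.2.2 + y.2.2 + x.1 * y.2.1 = z.2.2 then (1 : AlgebraicClosure (ZMod p)) else 0) ≤ (p : ℝ) ^ (4 - c)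

/-- item stmt-MatrixMultiplication-4348 · crux · rank 3 · open · by planner
why it might fail: no mechanism beyond hoped-for Hensel lifting; finite-level lifting fails (arXiv:2212.01175 §5: no rank-47 F_2-scheme of ⟨4,4,4⟩ lifts to ℤ/4); transfer IS false for non-concise reductions ((P⊗P⊗P)·⟨n⟩, det P = p) and for asymptotic SUBRANK (T_(ℤ/2): 2 over ℂ vs 1.89 over F̄_2).
sources: arXiv:2212.01175, BurgisserClausenShokrollahi1997, ChristandlVranaZuiddam2023, arXiv:2602.13171
[crux] characteristic transfer of asymptotic rank for the Heisenberg table (card Crux 1, CT-lift):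
for every prime p, R~_ℂ(T_p) ≤ R~ over F̄_p of the same 0/1 tensor T_p (equivalently over any field
of characteristic p, ranks only dropping under extension; ℂ may be replaced by any algebraically
closed field of characteristic 0). The novel load-bearing ingredient: it makes characteristic-p
methods admissible for the complex exponent. Proposed mechanism (sibling card
hensel-rees-obstruction-calculus): near-optimal F̄_p-decompositions of T_p^(⊗n) become
Hensel-unobstructed after padding p^(o(n)), lift to Witt vectors W(F̄_p) ⊂ an algebraically closed
field of characteristic 0, and R~ over all such fields agrees with R~_ℂ. [difficulty: open-problem] -/
@[route_item "route-MatrixMultiplication-ModularHeisenberg", crux]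
def CharacteristicLift : Prop :=
  ∀ (p : ℕ) [Fact p.Prime], Literature.Computability.AlgebraicComplexity.asymptoticRank (fun z x y : Fin p × Fin p × Fin p => if x.1 + y.1 = z.1 ∧ x.2.1 + y.2.1 = z.2.1 ∧ x.2.2 + y.2.2 + x.1 * y.2.1 = z.2.2 then (1 : ℂ) else 0) ≤ Literature.Computability.AlgebraicComplexity.asymptoticRank (fun z x y : Fin p × Fin p × Fin p => if x.1 + y.1 = z.1 ∧ x.2.1 + y.2.1 = z.2.1 ∧ x.2.2 + y.2.2 + x.1 * y.2.1 = z.2.2 then (1 : AlgebraicClosure (ZMod p)) else 0)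

/-- item stmt-MatrixMultiplication-4349 · crux · rank 4 · open · by planner
why it might fail: F̄_p[H_p] is unital non-commutative ⇒ bR > p³ (BlaserLysikov2016 Cor. 7) and local ⇒ irreversible (slice rank < (1−c)p³, BCCGU17 §3), so no duality shortcut; its degenerations u(h_p), F̄_p[x,y,z]/(x^p,…) bound it from below only; nothing below p⁴ is known; with CTLift it is equivalent to ω=2.
sources: BlaserLysikov2016, BlasiakChurchCohnGrochowUmans2017, BurgisserClausenShokrollahi1997, CohnUmans2003, Sawin2018
[crux] asymptotic-rank minimality of the modular Heisenberg group algebra along the primes (card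
Crux 2, MH): for every ε > 0 there is p₀ such that for all primes p ≥ p₀ the asymptotic rank over
F̄_p of T_p is at most p^(3+ε). T_p is concise (unital algebra) so p³ is a lower bound in every
characteristic; MH is the asymptotic rank conjecture over F̄_p for this one family with
sub-polynomial slack. Implies SubQuarticModular; with CharacteristicLift and the lower frame it
gives ω(ℂ) = 2. [deps: SubQuarticModular] [difficulty: open-problem] -/
@[route_item "route-MatrixMultiplication-ModularHeisenberg", crux]
def ModularHeisenbergMinimal : Prop :=
  ∀ ε : ℝ, 0 < ε → ∃ p₀ : ℕ, ∀ (p : ℕ) [Fact p.Prime], p₀ ≤ p → Literature.Computability.AlgebraicComplexity.asymptoticRank (fun z x y : Fin p × Fin p × Fin p => if x.1 + y.1 = z.1 ∧ x.2.1 + y.2.1 = z.2.1 ∧ x.2.2 + y.2.2 + x.1 * y.2.1 = z.2.2 then (1 : AlgebraicClosure (ZMod p)) else 0) ≤ (p : ℝ) ^ (3 + ε)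

/-- item stmt-MatrixMultiplication-4350 · support · rank 9 · open · by planner
sources: CohnUmans2003, BurgisserClausenShokrollahi1997, AlmanDuanVassilevskaWilliamsXuXuZhou2025
[support] the complex lower frame: for every prime p, (p−1)·p^ω(ℂ) ≤ R~_ℂ(T_p). Provable now from
the cone: T_p is (a reindexing of) groupTensor ℂ H_p for the evident group structure on (Fin p)³
(GroupAlgebraTensor.groupTensor, groupTensor_eq_structureTensor); Wedderburn φ : ℂ[H_p] ≃ₐ ∏
M_(d_i)(ℂ) (WedderburnBlocks.exists_algEquiv_pi_matrix, PROVED) with p² blocks of size 1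
(H_p/[H_p,H_p] ≅ (ℤ/p)²) and p−1 blocks of size p (d_i² ≤ [H_p : Z] = p², Σ d_i² = p³; or explicitly
via the p−1 Weyl clock–shift representations x ↦ shift, y ↦ diag(ζ^(jb)));
structureTensor_restrictsTo_of_algEquiv + structureTensor_blockBasis_eq_matMulDirectSum give T_p ≥
⊕_i ⟨d_i,d_i,d_i⟩, restriction-monotonicity of R~ (TensorRestrictsTo.kroneckerPow + tensorRank_le)
and sum_rpow_omega_le_asymptoticRank (Schönhage τ-theorem, R~ form, PROVED) give Σ_i d_i^ω ≤
R~_ℂ(T_p), and Σ_i d_i^ω ≥ (p−1)p^ω. [difficulty: provable-now] -/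
@[route_item "route-MatrixMultiplication-ModularHeisenberg", crux]
def HeisenbergLowerFrame : Prop :=
  ∀ p : ℕ, p.Prime → ((p : ℝ) - 1) * (p : ℝ) ^ Literature.Computability.AlgebraicComplexity.omega ℂ ≤ Literature.Computability.AlgebraicComplexity.asymptoticRank (fun z x y : Fin p × Fin p × Fin p => if x.1 + y.1 = z.1 ∧ x.2.1 + y.2.1 = z.2.1 ∧ x.2.2 + y.2.2 + x.1 * y.2.1 = z.2.2 then (1 : ℂ) else 0)

/-- item stmt-MatrixMultiplication-4351 · support · rank 9 · open · by planner
sources: BlaserLysikov2016, BurgisserClausenShokrollahi1997, Blaser2013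
[support] the trivial end of the dial (δ = 1 ↔ ω ≤ 3) in characteristic p: for every prime p, R~
over F̄_p of T_p is at most p⁴. Proof: N = {(0,b,c)} ≅ (ℤ/p)² is abelian normal of index p with
coset representatives x^i = (i,0,0), and (x^i β)(x^j β') = x^(i+j)·Ad_(x^(−j))(β)·β', so T_p is a
restriction of ⊕_((i,j) ∈ (ℤ/p)²) T_(F̄_p[N]) (p² twisted copies; R~ is subadditive), and
R~(F̄_p[N]) ≤ bR(F̄_p[u,v]/(u^p,v^p)) = p² (smoothable: arXiv:1606.04253 Def. 3 / Cor. 7, over any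
algebraically closed field) by the smoothing u^p − δ^(p−1)u (Lagrange idempotents at 0, δζ^i give an
order-O(p²) approximate decomposition over F̄_p[δ]; asymptoticRank_le_algBorderRank). Builds the
char-p infrastructure (coset presentation, minimal border rank of F̄_p[(ℤ/p)²]) every attack on
SubQuarticModular starts from. [difficulty: M] -/
@[route_item "route-MatrixMultiplication-ModularHeisenberg"]
def QuarticCalibration : Prop :=
  ∀ (p : ℕ) [Fact p.Prime], Literature.Computability.AlgebraicComplexity.asymptoticRank (fun z x y : Fin p × Fin p × Fin p => if x.1 + y.1 = z.1 ∧ x.2.1 + y.2.1 = z.2.1 ∧ x.2.2 + y.2.2 + x.1 * y.2.1 = z.2.2 then (1 : AlgebraicClosure (ZMod p)) else 0) ≤ (p : ℝ) ^ (4 : ℝ)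

/-- item stmt-MatrixMultiplication-4352 · assembly · rank 1 · open · by planner
sources: BurgisserClausenShokrollahi1997, CohnUmans2003
[assembly] HeisenbergLowerFrame → CharacteristicLift → ModularHeisenbergMinimal →
MatrixMultiplication (ω(ℂ) = 2). -/
@[route_item "route-MatrixMultiplication-ModularHeisenberg"]
def Assembly : Prop :=
  HeisenbergLowerFrame → CharacteristicLift → ModularHeisenbergMinimal → MatrixMultiplication

/-! D-0027 §2.1 — DECIDING THEOREM (planner-authored via `route open/edit --closes-file`; by planner-rbadge-MatrixMultiplication-ModularHei-07bc92c3-g2-0 2026-08-15T16:12:51Z):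
its hypotheses are this route's items and its conclusion the sub-problem Statement (glue_lint), and it elaborates with this file. -/

/-- DECIDING THEOREM (D-0027 §2.1): the complex lower frame (`HeisenbergLowerFrame`:
`(p−1)·p^ω(ℂ) ≤ R~_ℂ(T_p)` for every prime `p`), characteristic transfer (`CharacteristicLift`:
`R~_ℂ(T_p) ≤ R~_(F̄_p)(T_p)`) and modular minimality (`ModularHeisenbergMinimal`:
`R~_(F̄_p)(T_p) ≤ p^(3+ε)` for all primes `p ≥ p₀(ε)`) decide `ω(ℂ) = 2`: if `ω > 2` put
`δ := (ω−2)/2 > 0`, take `ε := δ` and a prime `p ≥ max(p₀, N₁, 2)` with `p^δ > 2`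
(`Nat.exists_infinite_primes`, `tendsto_rpow_atTop`); chaining gives `(p−1)·p^ω ≤ p^(3+δ)`,
i.e. after cancelling `p^(2+δ) > 0`, `(p−1)·p^δ ≤ p`; but `(p−1)·p^δ > 2(p−1) ≥ p` — contradiction.
So `ω(ℂ) ≤ 2`, and `2 ≤ ω(ℂ)` is the flattening bound `omega_two_le ℂ` (FlatteningBound, PROVED). -/
@[closes "route-MatrixMultiplication-ModularHeisenberg"] theorem closes (hF : HeisenbergLowerFrame) (hL : CharacteristicLift) (hM : ModularHeisenbergMinimal) : MatrixMultiplication := by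
  show Literature.Computability.AlgebraicComplexity.omega ℂ = 2
  refine le_antisymm ?_ (Literature.Computability.AlgebraicComplexity.omega_two_le ℂ)
  by_contra hgt
  rw [not_le] at hgt
  set ω : ℝ := Literature.Computability.AlgebraicComplexity.omega ℂ with hωdef
  have hδ : 0 < (ω - 2) / 2 := by linarith
  obtain ⟨p₀, hp₀⟩ := hM ((ω - 2) / 2) hδ
  have hev : ∀ᶠ n : ℕ in Filter.atTop, (2 : ℝ) < (n : ℝ) ^ ((ω - 2) / 2) :=
    ((tendsto_rpow_atTop hδ).comp tendsto_natCast_atTop_atTop).eventually_gt_atTop 2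
  obtain ⟨N₁, hN₁⟩ := Filter.eventually_atTop.1 hev
  obtain ⟨p, hpge, hp⟩ := Nat.exists_infinite_primes (max p₀ (max N₁ 2))
  haveI : Fact p.Prime := ⟨hp⟩
  have hp₀p : p₀ ≤ p := le_trans (le_max_left _ _) hpge
  have hN₁p : N₁ ≤ p := le_trans ((le_max_left _ _).trans (le_max_right _ _)) hpge
  have h2p : 2 ≤ p := le_trans ((le_max_right _ _).trans (le_max_right _ _)) hpge
  have hchain : ((p : ℝ) - 1) * (p : ℝ) ^ ω ≤ (p : ℝ) ^ (3 + (ω - 2) / 2) :=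
    (hF p hp).trans ((hL p).trans (hp₀ p hp₀p))
  have hD : (2 : ℝ) < (p : ℝ) ^ ((ω - 2) / 2) := hN₁ p hN₁p
  have hp2 : (2 : ℝ) ≤ (p : ℝ) := by exact_mod_cast h2p
  have hppos : (0 : ℝ) < (p : ℝ) := by linarith
  have hsplit₁ : (p : ℝ) ^ ω = (p : ℝ) ^ (2 + (ω - 2) / 2) * (p : ℝ) ^ ((ω - 2) / 2) := by
    rw [← Real.rpow_add hppos]; congr 1; ring
  have hsplit₂ : (p : ℝ) ^ (3 + (ω - 2) / 2) = (p : ℝ) * (p : ℝ) ^ (2 + (ω - 2) / 2) := by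
    rw [show (3 + (ω - 2) / 2) = 1 + (2 + (ω - 2) / 2) by ring, Real.rpow_add hppos, Real.rpow_one]
  have hA : 0 < (p : ℝ) ^ (2 + (ω - 2) / 2) := Real.rpow_pos_of_pos hppos _
  rw [hsplit₁, hsplit₂] at hchain
  have hkey : ((p : ℝ) - 1) * (p : ℝ) ^ ((ω - 2) / 2) ≤ (p : ℝ) := by
    have h' : ((p : ℝ) - 1) * (p : ℝ) ^ ((ω - 2) / 2) * (p : ℝ) ^ (2 + (ω - 2) / 2) ≤
        (p : ℝ) * (p : ℝ) ^ (2 + (ω - 2) / 2) := by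
      calc ((p : ℝ) - 1) * (p : ℝ) ^ ((ω - 2) / 2) * (p : ℝ) ^ (2 + (ω - 2) / 2)
          = ((p : ℝ) - 1) * ((p : ℝ) ^ (2 + (ω - 2) / 2) * (p : ℝ) ^ ((ω - 2) / 2)) := by ring
        _ ≤ (p : ℝ) * (p : ℝ) ^ (2 + (ω - 2) / 2) := hchain
    exact le_of_mul_le_mul_right h' hA
  have hlow : 2 * ((p : ℝ) - 1) < ((p : ℝ) - 1) * (p : ℝ) ^ ((ω - 2) / 2) := by
    have hpm1 : (0 : ℝ) < (p : ℝ) - 1 := by linarith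
    nlinarith
  linarith

end Summit.MatrixMultiplication.MatrixMultiplication.Theses.ModularHeisenberg
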